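import Literature.NumberTheory.EllipticCurves.FormalGroupLawNormedAlgebraProofs
import Literature.NumberTheory.EllipticCurves.CanonicalPAdicHeightSqKExistenceProofs
import Literature.NumberTheory.EllipticCurves.VariableChangePointsMap
import HarnessLib

/-!
# The squared theta relation of the `p`-adic sigma function at points of a complete ultrametric
# normed `ℚ_p`-algebra `L`, and at the images of number-field points under embeddings `H → L`
# (proofs only)

Trunk T-NT-EC (`Literature/NumberTheory/EllipticCurves`). Pure proof file (no definitions, no named
facts): §Theta of `CanonicalPAdicHeightSqKExistenceProofs.lean` (Mazur–Tate 1991 Thm. 3.1 /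
Blakestad–Grant 2023 Thm. 15 at POINTS: `Σ(z(P+Q))·Σ(z(P−Q)) = (x(Q) − x(P))²·Σ(z(P))²·Σ(z(Q))²`)
with the points taken in `E(L)` for a complete ultrametric normed `ℚ_p`-algebra field `L` (`ℂ_p`),
resp. at the images of points of `E(H)`, `H` a number field, under a ring homomorphism `σ : H → L`
— the local identity behind «`h_ρ` is quadratic because of property IV of `σ`» (MST 2006 §2.7) at a
place of `H` above `p` with ANY ramification, in the squared form valid at `p = 2`. Third pointwise
brick (A3) of the existence of the canonical cyclotomic `p`-adic height over `H`
(`CanonicalPAdicHeightCyc.lean`). Inputs: the formal identity `IsMazurTateSigmaSqPair.thetaSq_formal`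
(tree), evaluated by `padicAlgEval₂ L` (`PadicSeriesEvaluationNormedAlgebra.lean`), the chord case of
the formal group law and the dictionary at `L`-points (`FormalGroupLawNormedAlgebraProofs`,
`FormalGroupDictionaryNormedAlgebraProofs`). Only generic pairs (`x(P) ≠ x(Q)`) are treated.

PROVED: `IsMazurTateSigmaSqPair.theta_alg` (any sigma-squared pair, `L`-points of `V ⊗ L`),
`padicAlgEval_padicSigmaSq_theta_alg` (for `Σ_p` of `W ⊗ ℚ_p`, `W/ℚ` with `ℤ`-integral equation),
`padicAlgEval_padicSigmaSq_theta_ringHom` (at `σ`-images of `H`-points, `σ : H →+* L`),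
`padicAlgEval_padicSigmaSq_ne_zero` (`Σ_p(t) ≠ 0` for `0 < ‖t‖ < 1` in `L`).

## Sources

* B. Mazur, J. Tate, Duke Math. J. 62 (1991), Thm. 3.1; C. Blakestad, D. Grant, arXiv:2306 (2023),
  Prop. 14, Thm. 15 (the theta relation of `σ`).
* B. Mazur, W. Stein, J. Tate, Doc. Math. Extra Vol. Coates (2006), §2.3, §2.7.
* J. H. Silverman, Math. Ann. 332 (2005), §5 Rem. 2 (`σ²` at `p = 2`).
-/

noncomputable section

open scoped Classical
open PowerSeries Literature.NumberTheory.EllipticCurves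

namespace WeierstrassCurve

/-! ### Evaluating the two sides of the squared theta relation at `(u, v) ∈ L²` -/

section Eval

variable {p : ℕ} [Fact p.Prime] (V : WeierstrassCurve ℚ_[p]) [hV : V.IsIntegral ℤ_[p]]
  {L : Type*} [NontriviallyNormedField L] [NormedAlgebra ℚ_[p] L] [IsUltrametricDist L]
  [CompleteSpace L]

variable {V} in
/-- Value of the left side `(Σ(F)·Σ(u -_F v)·u⁴·v⁴)(u, v)` at an `L`-point pair.
[cite: BlakestadGrant2023, Prop. 14] -/
private theorem padicAlgEval₂_thetaSqLHS {Sq : ℚ_[p]⟦X⟧} (hSq : IsPadicInt Sq) {u v : L}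
    (hu : ‖u‖ < 1) (hv : ‖v‖ < 1) :
    padicAlgEval₂ L (Sq.subst V.formalGroupLaw * Sq.subst V.formalGroupLawSub *
        (MvPowerSeries.X 0 : MvPowerSeries (Fin 2) ℚ_[p]) ^ 4 * (MvPowerSeries.X 1) ^ 4) u v =
      padicAlgEval L Sq (padicAlgEval₂ L V.formalGroupLaw u v) *
        padicAlgEval L Sq (padicAlgEval₂ L V.formalGroupLaw u (padicAlgEval L V.formalNeg v)) *
          u ^ 4 * v ^ 4 := by
  have hF := V.isPadicInt_formalGroupLaw
  have h1 := hSq.powerSeries_subst hF V.hasSubst_formalGroupLaw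
  have hFs := V.isPadicInt_formalGroupLawSub
  have h2 := hSq.powerSeries_subst hFs
    (PowerSeries.HasSubst.of_constantCoeff_zero V.constantCoeff_formalGroupLawSub)
  have hX0 : IsPadicInt ((MvPowerSeries.X 0 : MvPowerSeries (Fin 2) ℚ_[p]) ^ 4) :=
    (IsPadicInt.X 0).pow 4
  have hX1 : IsPadicInt ((MvPowerSeries.X 1 : MvPowerSeries (Fin 2) ℚ_[p]) ^ 4) :=
    (IsPadicInt.X 1).pow 4
  rw [padicAlgEval₂_mul ((h1.mul h2).mul hX0) hX1 hu hv, padicAlgEval₂_mul (h1.mul h2) hX0 hu hv,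
    padicAlgEval₂_mul h1 h2 hu hv, padicAlgEval₂_pow (IsPadicInt.X 0) hu hv,
    padicAlgEval₂_pow (IsPadicInt.X 1) hu hv, padicAlgEval₂_X, padicAlgEval₂_X,
    padicAlgEval₂_subst hSq hF V.constantCoeff_formalGroupLaw hu hv,
    padicAlgEval₂_subst hSq hFs V.constantCoeff_formalGroupLawSub hu hv]
  unfold formalGroupLawSub
  rw [padicAlgEval₂_substPair hF (IsPadicInt.X 0) (V.isPadicInt_formalNeg.powerSeries_subst
      (IsPadicInt.X 1) (PowerSeries.HasSubst.X 1)) (MvPowerSeries.constantCoeff_X 0)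
      (V.constantCoeff_formalNeg_subst_X 1) hu hv,
    padicAlgEval₂_X, padicAlgEval₂_subst_X V.isPadicInt_formalNeg hu hv]
  rfl

variable {V} in
/-- Value of the right side `((u²X(v) − v²X(u))²·Σ(u)²·Σ(v)²)(u, v)` at an `L`-point pair.
[cite: BlakestadGrant2023, Prop. 14] -/
private theorem padicAlgEval₂_thetaSqRHS {Sq : ℚ_[p]⟦X⟧} (hSq : IsPadicInt Sq) {u v : L}
    (hu : ‖u‖ < 1) (hv : ‖v‖ < 1) :
    padicAlgEval₂ L (((MvPowerSeries.X 0 : MvPowerSeries (Fin 2) ℚ_[p]) ^ 2 *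
          V.formalXMulSq.subst (MvPowerSeries.X 1 : MvPowerSeries (Fin 2) ℚ_[p]) -
          (MvPowerSeries.X 1) ^ 2 *
            V.formalXMulSq.subst (MvPowerSeries.X 0 : MvPowerSeries (Fin 2) ℚ_[p])) ^ 2 *
        Sq.subst (MvPowerSeries.X 0 : MvPowerSeries (Fin 2) ℚ_[p]) ^ 2 *
        Sq.subst (MvPowerSeries.X 1 : MvPowerSeries (Fin 2) ℚ_[p]) ^ 2) u v =
      (u ^ 2 * padicAlgEval L V.formalXMulSq v - v ^ 2 * padicAlgEval L V.formalXMulSq u) ^ 2 *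
        padicAlgEval L Sq u ^ 2 * padicAlgEval L Sq v ^ 2 := by
  have hXs0 := V.isPadicInt_formalXMulSq.powerSeries_subst (IsPadicInt.X (0 : Fin 2))
    (PowerSeries.HasSubst.X 0)
  have hXs1 := V.isPadicInt_formalXMulSq.powerSeries_subst (IsPadicInt.X (1 : Fin 2))
    (PowerSeries.HasSubst.X 1)
  have hs0 := hSq.powerSeries_subst (IsPadicInt.X (0 : Fin 2)) (PowerSeries.HasSubst.X 0)
  have hs1 := hSq.powerSeries_subst (IsPadicInt.X (1 : Fin 2)) (PowerSeries.HasSubst.X 1)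
  have hX0 : IsPadicInt ((MvPowerSeries.X 0 : MvPowerSeries (Fin 2) ℚ_[p]) ^ 2) :=
    (IsPadicInt.X 0).pow 2
  have hX1 : IsPadicInt ((MvPowerSeries.X 1 : MvPowerSeries (Fin 2) ℚ_[p]) ^ 2) :=
    (IsPadicInt.X 1).pow 2
  have hd := (hX0.mul hXs1).sub (hX1.mul hXs0)
  rw [padicAlgEval₂_mul ((hd.pow 2).mul (hs0.pow 2)) (hs1.pow 2) hu hv,
    padicAlgEval₂_mul (hd.pow 2) (hs0.pow 2) hu hv, padicAlgEval₂_pow hd hu hv,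
    padicAlgEval₂_sub (hX0.mul hXs1) (hX1.mul hXs0) hu hv, padicAlgEval₂_mul hX0 hXs1 hu hv,
    padicAlgEval₂_mul hX1 hXs0 hu hv, padicAlgEval₂_pow hs0 hu hv, padicAlgEval₂_pow hs1 hu hv,
    padicAlgEval₂_pow (IsPadicInt.X 0) hu hv, padicAlgEval₂_pow (IsPadicInt.X 1) hu hv,
    padicAlgEval₂_X, padicAlgEval₂_X, padicAlgEval₂_subst_X V.isPadicInt_formalXMulSq hu hv,
    padicAlgEval₂_subst_X V.isPadicInt_formalXMulSq hu hv, padicAlgEval₂_subst_X hSq hu hv,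
    padicAlgEval₂_subst_X hSq hu hv]
  rfl

/-! ### The squared theta relation at `L`-points -/

variable {V} in
/-- **The squared theta relation at `L`-points, for any sigma-squared pair, generic chord**: for
`V/ℚ_p` elliptic with `p`-integral coefficients, a sigma-squared pair `(Σ, c)` of `V`, and affine
`P = (x₁, y₁)`, `Q = (x₂, y₂) ∈ E(L)` with `‖x₁‖, ‖x₂‖ > 1`, `x₁ ≠ x₂`, `P + Q = (x₃, y₃)`,
`P − Q = (x₄, y₄)`:  `Σ̂(z₃)·Σ̂(z₄) = (x₂ − x₁)²·Σ̂(z₁)²·Σ̂(z₂)²` (`zᵢ = −xᵢ/yᵢ`, values by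
`padicAlgEval L`). Evaluate `thetaSq_formal` at `(z₁, z₂)`, read `F` as the chord
(`padicAlgEval₂_formalGroupLaw_of_add_eq`), `î(z₂) = z(−Q)`, `X̂(zᵢ) = xᵢzᵢ²`, cancel `z₁⁴z₂⁴`.
[cite: BlakestadGrant2023, Thm. 15] [cite: MazurTate1991, Thm. 3.1] -/
theorem IsMazurTateSigmaSqPair.theta_alg [V.IsElliptic] {Sq : ℚ_[p]⟦X⟧} {c : ℚ_[p]}
    (hpair : V.IsMazurTateSigmaSqPair Sq c) {x₁ y₁ x₂ y₂ x₃ y₃ x₄ y₄ : L}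
    (h₁ : (V.baseChange L).toAffine.Nonsingular x₁ y₁) (h₂ : (V.baseChange L).toAffine.Nonsingular x₂ y₂)
    (h₃ : (V.baseChange L).toAffine.Nonsingular x₃ y₃) (h₄ : (V.baseChange L).toAffine.Nonsingular x₄ y₄)
    (hS : (.some x₁ y₁ h₁ : (V.baseChange L).toAffine.Point) + .some x₂ y₂ h₂ = .some x₃ y₃ h₃)
    (hD : (.some x₁ y₁ h₁ : (V.baseChange L).toAffine.Point) - .some x₂ y₂ h₂ = .some x₄ y₄ h₄)
    (hx₁ : 1 < ‖x₁‖) (hx₂ : 1 < ‖x₂‖) (hx : x₁ ≠ x₂) :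
    padicAlgEval L Sq (-x₃ / y₃) * padicAlgEval L Sq (-x₄ / y₄) =
      (x₂ - x₁) ^ 2 * padicAlgEval L Sq (-x₁ / y₁) ^ 2 * padicAlgEval L Sq (-x₂ / y₂) ^ 2 := by
  have hint : IsPadicInt Sq := hpair.isPadicInt
  have hΘ := hpair.thetaSq_formal
  -- parameters
  obtain ⟨-, hu0, hu1, -, -⟩ := V.param_facts_alg h₁.1 hx₁
  obtain ⟨-, hv0, hv1, -, -⟩ := V.param_facts_alg h₂.1 hx₂
  set u : L := -x₁ / y₁ with hudef
  set v : L := -x₂ / y₂ with hvdef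
  -- `−Q` and `P − Q = P + (−Q)`
  have hn₂ : (V.baseChange L).toAffine.Nonsingular x₂ ((V.baseChange L).toAffine.negY x₂ y₂) :=
    (Affine.nonsingular_neg ..).mpr h₂
  have hnQ : -(.some x₂ y₂ h₂ : (V.baseChange L).toAffine.Point) =
      .some x₂ ((V.baseChange L).toAffine.negY x₂ y₂) hn₂ := by
    rw [Affine.Point.neg_some]
  have hD' : (.some x₁ y₁ h₁ : (V.baseChange L).toAffine.Point) +
      .some x₂ ((V.baseChange L).toAffine.negY x₂ y₂) hn₂ = .some x₄ y₄ h₄ := by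
    rw [← hnQ, ← sub_eq_add_neg]; exact hD
  have hznQ : padicAlgEval L V.formalNeg v = -x₂ / (V.baseChange L).toAffine.negY x₂ y₂ :=
    V.padicAlgEval_formalNeg_eq h₂.1 hx₂
  -- the chord at `(P, Q)` and `(P, −Q)`
  have hadd : padicAlgEval₂ L V.formalGroupLaw u v = -x₃ / y₃ :=
    (padicAlgEval₂_formalGroupLaw_of_add_eq (V := V) h₁ h₂ h₃ hS hx₁ hx₂ hx).2
  have hsub : padicAlgEval₂ L V.formalGroupLaw u (padicAlgEval L V.formalNeg v) = -x₄ / y₄ := by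
    rw [hznQ]; exact (padicAlgEval₂_formalGroupLaw_of_add_eq (V := V) h₁ hn₂ h₄ hD' hx₁ hx₂ hx).2
  -- the dictionary for `X = z²x`
  have hXu : padicAlgEval L V.formalXMulSq u = x₁ * u ^ 2 := V.padicAlgEval_formalXMulSq_eq h₁.1 hx₁
  have hXv : padicAlgEval L V.formalXMulSq v = x₂ * v ^ 2 := V.padicAlgEval_formalXMulSq_eq h₂.1 hx₂
  -- evaluate the formal identity at `(u, v)`
  have key := congrArg (fun G => padicAlgEval₂ L G u v) hΘ
  rw [padicAlgEval₂_thetaSqLHS hint hu1 hv1, padicAlgEval₂_thetaSqRHS hint hu1 hv1, hadd, hsub,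
    hXu, hXv] at key
  have huv : u ^ 4 * v ^ 4 ≠ 0 := mul_ne_zero (pow_ne_zero 4 hu0) (pow_ne_zero 4 hv0)
  apply mul_right_cancel₀ huv
  linear_combination key

end Eval

/-! ### For `Σ_p` of `W ⊗ ℚ_p`, `W/ℚ`: at `L`-points and at `σ`-images of number-field points -/

section SigmaSq

variable (W : WeierstrassCurve ℚ) [W.IsElliptic] [W.IsIntegral ℤ] (p : ℕ) [Fact p.Prime]
  {L : Type*} [NontriviallyNormedField L] [CharZero L] [NormedAlgebra ℚ_[p] L] [IsUltrametricDist L]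
  [CompleteSpace L]

omit [W.IsElliptic] [W.IsIntegral ℤ] [CharZero L] in
/-- **`Σ_p(t) ≠ 0` for `0 < ‖t‖ < 1` in `L`** (`Σ_p = t²·G`, `G ∈ 1 + tℤ_p⟦t⟧`, so `‖G(t) − 1‖ < 1`).
[cite: MazurSteinTate2006, §2.3] [cite: Silverman2005DivPoly, §5 Rem. 2] -/
theorem padicAlgEval_padicSigmaSq_ne_zero {t : L} (ht0 : t ≠ 0) (ht : ‖t‖ < 1) :
    padicAlgEval L (W.baseChange ℚ_[p]).padicSigmaSq t ≠ 0 := by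
  obtain ⟨hint, h0, h1, h2⟩ := (W.baseChange ℚ_[p]).padicSigmaSq_normalised
  set G : ℚ_[p]⟦X⟧ := PowerSeries.mk fun n => coeff (n + 2) (W.baseChange ℚ_[p]).padicSigmaSq
    with hGdef
  have hG : IsPadicInt G := isPadicInt_shift hint 2
  have hSG : (W.baseChange ℚ_[p]).padicSigmaSq = X ^ 2 * G := by
    ext n
    rw [coeff_X_pow_mul']
    split_ifs with hn
    · rw [hGdef, coeff_mk, Nat.sub_add_cancel hn]
    · interval_cases n
      · rw [coeff_zero_eq_constantCoeff_apply]; exact h0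
      · exact h1
  have hG0 : constantCoeff (G - 1) = 0 := by
    rw [map_sub, map_one, ← coeff_zero_eq_constantCoeff_apply, hGdef, coeff_mk, zero_add, h2, sub_self]
  have hGt : ‖padicAlgEval L G t - 1‖ < 1 := by
    have := norm_padicAlgEval_le (hG.sub IsPadicInt.one) hG0 ht
    rw [padicAlgEval_sub hG IsPadicInt.one ht, padicAlgEval_one] at this
    exact this.trans_lt ht
  have hX : IsPadicInt (X : ℚ_[p]⟦X⟧) := IsPadicInt.powerSeries_X
  have heval : padicAlgEval L (W.baseChange ℚ_[p]).padicSigmaSq t = t ^ 2 * padicAlgEval L G t := by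
    rw [hSG, padicAlgEval_mul (hX.pow 2) hG ht, padicAlgEval_pow hX ht 2, padicAlgEval_X]
  intro hzero
  rw [heval, mul_eq_zero] at hzero
  rcases hzero with h | h
  · exact ht0 (pow_eq_zero_iff (two_ne_zero) |>.mp h)
  · rw [h, zero_sub, norm_neg, norm_one] at hGt
    exact lt_irrefl _ hGt

omit [CharZero L] in
/-- **The squared theta relation at `L`-points for `Σ_p = padicSigmaSq`** of `W ⊗ ℚ_p` (`W/ℚ` elliptic
with `ℤ`-integral equation, `p` a prime at which `W ⊗ ℚ_p` carries a sigma-squared pair), generic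
chord: `Σ_p(z₃)·Σ_p(z₄) = (x₂ − x₁)²·Σ_p(z₁)²·Σ_p(z₂)²`. [cite: BlakestadGrant2023, Thm. 15]
[cite: MazurTate1991, Thm. 3.1] -/
theorem padicAlgEval_padicSigmaSq_theta_alg
    (hex : ∃ Sq : PowerSeries ℚ_[p], ∃ c : ℚ_[p], (W.baseChange ℚ_[p]).IsMazurTateSigmaSqPair Sq c)
    {x₁ y₁ x₂ y₂ x₃ y₃ x₄ y₄ : L}
    (h₁ : ((W.baseChange ℚ_[p]).baseChange L).toAffine.Nonsingular x₁ y₁)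
    (h₂ : ((W.baseChange ℚ_[p]).baseChange L).toAffine.Nonsingular x₂ y₂)
    (h₃ : ((W.baseChange ℚ_[p]).baseChange L).toAffine.Nonsingular x₃ y₃)
    (h₄ : ((W.baseChange ℚ_[p]).baseChange L).toAffine.Nonsingular x₄ y₄)
    (hS : (.some x₁ y₁ h₁ : ((W.baseChange ℚ_[p]).baseChange L).toAffine.Point) + .some x₂ y₂ h₂ =
      .some x₃ y₃ h₃)
    (hD : (.some x₁ y₁ h₁ : ((W.baseChange ℚ_[p]).baseChange L).toAffine.Point) - .some x₂ y₂ h₂ =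
      .some x₄ y₄ h₄)
    (hx₁ : 1 < ‖x₁‖) (hx₂ : 1 < ‖x₂‖) (hx : x₁ ≠ x₂) :
    padicAlgEval L (W.baseChange ℚ_[p]).padicSigmaSq (-x₃ / y₃) *
        padicAlgEval L (W.baseChange ℚ_[p]).padicSigmaSq (-x₄ / y₄) =
      (x₂ - x₁) ^ 2 * padicAlgEval L (W.baseChange ℚ_[p]).padicSigmaSq (-x₁ / y₁) ^ 2 *
        padicAlgEval L (W.baseChange ℚ_[p]).padicSigmaSq (-x₂ / y₂) ^ 2 := by
  haveI : (W.baseChange ℚ_[p]).IsElliptic := by rw [baseChange]; infer_instance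
  have hpair := isMazurTateSigmaSqPair_padicSigmaSq (W := W.baseChange ℚ_[p]) (Or.inr hex)
  exact hpair.theta_alg h₁ h₂ h₃ h₄ hS hD hx₁ hx₂ hx

omit [W.IsElliptic] [W.IsIntegral ℤ] [IsUltrametricDist L] [CompleteSpace L] in
variable (L) in
/-- `(W ⊗ ℚ_p) ⊗ L = W ⊗ L` (there is only one ring homomorphism `ℚ → L`). [folklore] -/
private theorem baseChange_padic_baseChange :
    (W.baseChange ℚ_[p]).baseChange L = W.baseChange L := by
  rw [baseChange, baseChange, baseChange, map_map]
  congr 1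
  exact Subsingleton.elim _ _

/-- **The squared theta relation at the `σ`-images of number-field points.** For `W/ℚ` elliptic with
`ℤ`-integral equation, `p` a prime at which `W ⊗ ℚ_p` carries a sigma-squared pair, a number field
`H`, a ring homomorphism `σ : H → L` into a complete ultrametric normed `ℚ_p`-algebra field, and
affine `P = (x₁, y₁)`, `Q = (x₂, y₂) ∈ E(H)` with `x₁ ≠ x₂`, `‖σ x₁‖, ‖σ x₂‖ > 1`, `P + Q = (x₃, y₃)`,
`P − Q = (x₄, y₄)`:
`Σ_p(σz₃)·Σ_p(σz₄) = (σx₂ − σx₁)²·Σ_p(σz₁)²·Σ_p(σz₂)²` (`zᵢ = −xᵢ/yᵢ`) — the `L`-point relation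
transported along Mathlib's homomorphism `Point.map σ : E(H) → E(L)`. The local identity at a place
of `H` above `p` of any ramification, in the squared form valid at `p = 2`.
[cite: MazurSteinTate2006, §2.7] [cite: MazurTate1991, Thm. 3.1] -/
theorem padicAlgEval_padicSigmaSq_theta_ringHom
    (hex : ∃ Sq : PowerSeries ℚ_[p], ∃ c : ℚ_[p], (W.baseChange ℚ_[p]).IsMazurTateSigmaSqPair Sq c)
    (H : Type) [Field H] [NumberField H] (σ : H →+* L) {x₁ y₁ x₂ y₂ x₃ y₃ x₄ y₄ : H}
    (h₁ : (W.baseChange H).toAffine.Nonsingular x₁ y₁)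
    (h₂ : (W.baseChange H).toAffine.Nonsingular x₂ y₂)
    (h₃ : (W.baseChange H).toAffine.Nonsingular x₃ y₃)
    (h₄ : (W.baseChange H).toAffine.Nonsingular x₄ y₄)
    (hS : (.some x₁ y₁ h₁ : (W.baseChange H).toAffine.Point) + .some x₂ y₂ h₂ = .some x₃ y₃ h₃)
    (hD : (.some x₁ y₁ h₁ : (W.baseChange H).toAffine.Point) - .some x₂ y₂ h₂ = .some x₄ y₄ h₄)
    (hx₁ : 1 < ‖σ x₁‖) (hx₂ : 1 < ‖σ x₂‖) (hx : x₁ ≠ x₂) :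
    padicAlgEval L (W.baseChange ℚ_[p]).padicSigmaSq (-σ x₃ / σ y₃) *
        padicAlgEval L (W.baseChange ℚ_[p]).padicSigmaSq (-σ x₄ / σ y₄) =
      (σ x₂ - σ x₁) ^ 2 * padicAlgEval L (W.baseChange ℚ_[p]).padicSigmaSq (-σ x₁ / σ y₁) ^ 2 *
        padicAlgEval L (W.baseChange ℚ_[p]).padicSigmaSq (-σ x₂ / σ y₂) ^ 2 := by
  -- `σ` as a `ℚ`-algebra map and the transport of points `E(H) → E(L)`
  let σₐ : H →ₐ[ℚ] L := σ.toRatAlgHom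
  set f : (W.baseChange H).toAffine.Point →+ (W.baseChange L).toAffine.Point :=
    Affine.Point.map (W' := W.toAffine) (S := ℚ) σₐ with hf
  have hh : ∀ {x y : H}, (W.baseChange H).toAffine.Nonsingular x y →
      (W.baseChange L).toAffine.Nonsingular (σ x) (σ y) := fun {x y} h =>
    (Affine.baseChange_nonsingular (W := W.toAffine) (f := σₐ) σₐ.toRingHom.injective x y).mpr h
  have hfP : ∀ {x y : H} (h : (W.baseChange H).toAffine.Nonsingular x y),
      f (.some x y h) = .some (σ x) (σ y) (hh h) := fun h => rfl
  have hS' : (.some (σ x₁) (σ y₁) (hh h₁) : (W.baseChange L).toAffine.Point) +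
      .some (σ x₂) (σ y₂) (hh h₂) = .some (σ x₃) (σ y₃) (hh h₃) := by
    rw [← hfP h₁, ← hfP h₂, ← map_add, hS, hfP h₃]
  have hD' : (.some (σ x₁) (σ y₁) (hh h₁) : (W.baseChange L).toAffine.Point) -
      .some (σ x₂) (σ y₂) (hh h₂) = .some (σ x₄) (σ y₄) (hh h₄) := by
    rw [← hfP h₁, ← hfP h₂, ← map_sub, hD, hfP h₄]
  -- transport along `(W ⊗ ℚ_p) ⊗ L = W ⊗ L`
  have hVL := (baseChange_padic_baseChange W p L).symm
  set e := Affine.Point.congrEquiv hVL with he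
  have hn : ∀ {x y : L}, (W.baseChange L).toAffine.Nonsingular x y →
      ((W.baseChange ℚ_[p]).baseChange L).toAffine.Nonsingular x y := fun h => hVL ▸ h
  have heP : ∀ {x y : L} (h : (W.baseChange L).toAffine.Nonsingular x y),
      e (.some x y h) = .some x y (hn h) := fun h => Affine.Point.congrEquiv_some hVL h
  have hS'' : (.some (σ x₁) (σ y₁) (hn (hh h₁)) : ((W.baseChange ℚ_[p]).baseChange L).toAffine.Point) +
      .some (σ x₂) (σ y₂) (hn (hh h₂)) = .some (σ x₃) (σ y₃) (hn (hh h₃)) := by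
    rw [← heP (hh h₁), ← heP (hh h₂), ← map_add, hS', heP]
  have hD'' : (.some (σ x₁) (σ y₁) (hn (hh h₁)) : ((W.baseChange ℚ_[p]).baseChange L).toAffine.Point) -
      .some (σ x₂) (σ y₂) (hn (hh h₂)) = .some (σ x₄) (σ y₄) (hn (hh h₄)) := by
    rw [← heP (hh h₁), ← heP (hh h₂), ← map_sub, hD', heP]
  have hx' : σ x₁ ≠ σ x₂ := fun h => hx (σ.injective h)
  exact W.padicAlgEval_padicSigmaSq_theta_alg p hex (hn (hh h₁)) (hn (hh h₂)) (hn (hh h₃))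
    (hn (hh h₄)) hS'' hD'' hx₁ hx₂ hx'

omit [W.IsElliptic] in
/-- **`Σ_p(σ z(P)) ≠ 0`** for `P = (x, y) ∈ E(H)` with `‖σ x‖ > 1` (`ℤ`-integral equation; `σ z(P)`
lies in the punctured open unit disc of `L`). [cite: MazurSteinTate2006, §2.3] -/
theorem padicAlgEval_padicSigmaSq_ringHom_ne_zero (H : Type) [Field H] [NumberField H]
    (σ : H →+* L) {x y : H} (h : (W.baseChange H).toAffine.Nonsingular x y) (hx : 1 < ‖σ x‖) :
    padicAlgEval L (W.baseChange ℚ_[p]).padicSigmaSq (-σ x / σ y) ≠ 0 := by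
  let σₐ : H →ₐ[ℚ] L := σ.toRatAlgHom
  have hh : (W.baseChange L).toAffine.Nonsingular (σ x) (σ y) :=
    (Affine.baseChange_nonsingular (W := W.toAffine) (f := σₐ) σₐ.toRingHom.injective x y).mpr h
  have hVL := (baseChange_padic_baseChange W p L).symm
  have heq : ((W.baseChange ℚ_[p]).baseChange L).toAffine.Equation (σ x) (σ y) := (hVL ▸ hh).1
  obtain ⟨-, hz0, hz1, -, -⟩ := (W.baseChange ℚ_[p]).param_facts_alg heq hx
  exact W.padicAlgEval_padicSigmaSq_ne_zero p hz0 hz1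

end SigmaSq

end WeierstrassCurve

end
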